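import Mathlib
import Summits.NavierStokesRegularity.FluidComputer.AbcClassISymmetry
import Summits.NavierStokesRegularity.FluidComputer.AbcClassIISynthesis

/-!
# Class-I layer of the ABC certificate chains, Part B: the orbit-adapted basis families
(profile-cert-3 g9 — F5 implementation-3 seat, cell `ns-blowup`, 2026-08-27; the class-I twin of instab4 g6's
`AbcClassIIBasis`, same statements and proofs with the class predicate replaced)

HONEST FRAMING (human rulings D-0035/D-0074): nothing here is a claim about Navier–Stokes blow-up.
WHAT THIS IS NOT: not NS evidence. MODEL lane (class I). Sequel of `AbcClassIDefs` / `AbcClassISymmetry`: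
the properties of the class-I basis families `bfam i` (`i : Idx`, an orbit and an index of the
`stdOrthonormalBasis` of the real class-I space `realSpace O` of that orbit):

* `inner_coe_realSpace` (on `realSpace S` the complex pairing is the real inner product); the
  `extend` / `restrictTo` dictionary and the reality of pairings of conjugate-symmetric families are
  character-free (`AbcClassII.inner_eq_sum_extend`, `conj_sum_inner_of_isConjSymm`, … by name);
* `bfam_spec` (supported on one orbit, transversal, class I, conjugate-symmetric), `sum_inner_bfam`
  (COMPLEX orthonormality over any frequency set containing the orbit), `expand_real` /
  `expand_complex` / `eq_zero_of_orthogonal` (real and complex COMPLETENESS on each orbit: a transversal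
  class-I family supported in an orbit is the combination of the `bfam` with coefficients its pairings;
  via `c = ½((c + Jc) − i·i(c − Jc))`), `odim_le` (`d_O ≤ 288`).

Mathlib + the files named; no new definitions. bears_on LADDER-NS N5 / Z4-a(1) (CR rows T2/T4).
-/

noncomputable section

open scoped BigOperators ComplexConjugate InnerProductSpace
open Finset MeasureTheory UnitAddTorus

namespace Summit.NavierStokesRegularity.FluidComputer.AbcClassI

open Literature.Analysis.FunctionSpaces Literature.Analysis.FunctionSpaces.Torus
open Literature.Analysis.FunctionSpaces.EuclideanSpace
open Literature.Analysis.FluidPDE Literature.Analysis.FluidPDE.SteadyLattice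
open Literature.Analysis.FluidPDE.ScalarFourier
open Summit.NavierStokesRegularity.FluidComputer.AbcClassII (Fam crossForm secOp rotR rotS sgnAct sgnOrbit
  cube extend restrictTo extend_add extend_smul extend_zero rotR_add rotR_smul rotS_add rotS_smul
  crossForm_add crossForm_smul secOp_add secOp_smul restrictTo_add restrictTo_smul Orbit toOrbit onormSq
  osupNorm cubeOrbits nbrOrbits mem_sgnOrbit mem_sgnOrbit_self card_sgnOrbit_le sgnOrbit_eq_of_mem
  mem_sgnOrbit_comm sgnOrbit_eq_or_disjoint neg_mem_sgnOrbit neg_self_mem_sgnOrbit rotFreqR_mem_sgnOrbit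
  rotFreqS_mem_sgnOrbit freqNormSq_eq_of_mem_sgnOrbit supNorm_eq_of_mem_sgnOrbit mem_cube
  mem_cube_iff_supNorm cube_mono sgnOrbit_subset_cube zero_not_mem_sgnOrbit ne_zero_of_mem_sgnOrbit
  toOrbit_val toOrbit_eq_iff mem_cubeOrbits mem_nbrOrbits mem_nbrOrbits_comm card_nbrOrbits_le rotR_apply
  rotS_apply freqNormSq_rotFreq secOp_conj isConjSymm_secOp kdot_secOp mem_iff_of_orbitClosed
  isConjSymm_cut kdot_cut orbitClosed_cube_ne_zero orbitClosed_shell neg_mem_of_orbitClosed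
  isConjSymm_lerayCrossForm kdot_conj conj_eq_zero_of_not_mem linOp_zero_eq conj_theta_neg
  extend_apply_of_mem extend_apply_of_not_mem restrictTo_extend extend_restrictTo extend_sum
  inner_eq_sum_extend inner_conjVec_conjVec conj_sum_inner_of_isConjSymm sum_inner_eq_re_of_isConjSymm
  real_inner_eq_re real_smul_eq norm_lerayCrossForm_le sobolevWeight_one_eq)

/-! ## Part B. The class-I orbit-adapted basis families -/

section Basis

variable {S : Finset (Fin 3 → ℤ)}

/-- Equality of basis indices: same orbit and (heterogeneously) same basis index. -/
theorem idx_eq_iff (i j : AbcClassI.Idx) : i = j ↔ i.1 = j.1 ∧ HEq i.2 j.2 := by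
  obtain ⟨O, a⟩ := i
  obtain ⟨O', a'⟩ := j
  exact Sigma.mk.inj_iff

/-- **On the real class-I space of a symmetric set, the complex inner product IS the real one.** -/
theorem inner_coe_realSpace (hS : ∀ k ∈ S, -k ∈ S) (u v : AbcClassI.realSpace S) :
    (inner ℂ (u : EuclideanSpace ℂ (↥S × Fin 3)) (v : EuclideanSpace ℂ (↥S × Fin 3)) : ℂ) =
      ((inner ℝ u v : ℝ) : ℂ) := by
  have hre : (inner ℝ u v : ℝ) = (inner ℂ (u : EuclideanSpace ℂ (↥S × Fin 3))
      (v : EuclideanSpace ℂ (↥S × Fin 3)) : ℂ).re := real_inner_eq_re _ _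
  rw [hre, inner_eq_sum_extend]
  exact sum_inner_eq_re_of_isConjSymm u.2.2.2 v.2.2.2 hS

/-! ### The basis families -/

/-- Unfolding `bfam`. -/
theorem bfam_eq (i : AbcClassI.Idx) :
    AbcClassI.bfam i = extend i.1.1 ((AbcClassI.orbitBasis i.1 i.2 : AbcClassI.realSpace i.1.1) : EuclideanSpace ℂ (↥i.1.1 × Fin 3)) := rfl

/-- The basis family `bfam i` vanishes off its orbit. -/
theorem bfam_apply_of_not_mem (i : AbcClassI.Idx) {k : Fin 3 → ℤ} (hk : k ∉ i.1.1) : AbcClassI.bfam i k = 0 :=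
  extend_apply_of_not_mem _ hk

/-- The basis family `bfam i` is transversal, class I and conjugate-symmetric. -/
theorem bfam_spec (i : AbcClassI.Idx) :
    (∀ k : Fin 3 → ℤ, ∑ j : Fin 3, ((k j : ℤ) : ℂ) * AbcClassI.bfam i k j = 0) ∧ IsClassI (AbcClassI.bfam i) ∧
      Torus.IsConjSymm (AbcClassI.bfam i) :=
  (orbitBasis i.1 i.2).2

/-- **Orthonormality on one orbit**: `Σ_{k ∈ O} ⟪bfam ⟨O,a⟩ k, bfam ⟨O,a'⟩ k⟫ = δ_{a a'}`. -/
theorem sum_inner_bfam_same_orbit (O : Orbit) (a a' : Fin (AbcClassI.odim O)) :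
    ∑ k ∈ O.1, (inner ℂ (AbcClassI.bfam ⟨O, a⟩ k) (AbcClassI.bfam ⟨O, a'⟩ k) : ℂ) = if a = a' then 1 else 0 := by
  rw [bfam_eq, bfam_eq, ← inner_eq_sum_extend,
    inner_coe_realSpace (neg_mem_of_orbitClosed O.orbitClosed) (orbitBasis O a) (orbitBasis O a'),
    orthonormal_iff_ite.mp (orbitBasis O).orthonormal a a']
  split_ifs <;> simp

/-- **Orthonormality of the basis families** over any frequency set containing the orbit of `i`:
`Σ_{k ∈ T} ⟪bfam i k, bfam j k⟫ = δ_{ij}`. -/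
theorem sum_inner_bfam {T : Finset (Fin 3 → ℤ)} {i : AbcClassI.Idx} (hi : i.1.1 ⊆ T) (j : AbcClassI.Idx) :
    ∑ k ∈ T, (inner ℂ (AbcClassI.bfam i k) (AbcClassI.bfam j k) : ℂ) = if i = j then 1 else 0 := by
  obtain ⟨O, a⟩ := i
  obtain ⟨O', a'⟩ := j
  by_cases hO : O = O'
  · subst hO
    -- reduce to the orbit
    have h : ∑ k ∈ T, (inner ℂ (bfam ⟨O, a⟩ k) (bfam ⟨O, a'⟩ k) : ℂ) =
        ∑ k ∈ O.1, (inner ℂ (bfam ⟨O, a⟩ k) (bfam ⟨O, a'⟩ k) : ℂ) := by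
      refine (Finset.sum_subset hi fun k _ hk => ?_).symm
      rw [bfam_apply_of_not_mem ⟨O, a⟩ hk, inner_zero_left]
    rw [h, sum_inner_bfam_same_orbit]
    by_cases ha : a = a'
    · subst ha; simp
    · rw [if_neg ha]
      split_ifs with he
      · exact absurd (eq_of_heq ((idx_eq_iff _ _).mp he).2) ha
      · rfl
  · split_ifs with he
    · exact absurd ((idx_eq_iff _ _).mp he).1 hO
    refine Finset.sum_eq_zero fun k _ => ?_
    by_cases hk : k ∈ O.1
    · have hk' : k ∉ O'.1 := fun h' => Finset.disjoint_left.mp (Orbit.disjoint_of_ne hO) hk h'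
      rw [bfam_apply_of_not_mem ⟨O', a'⟩ hk', inner_zero_right]
    · rw [bfam_apply_of_not_mem ⟨O, a⟩ hk, inner_zero_left]

/-- The restriction of a transversal, class-I, conjugate-symmetric family supported in `S` lies in
`realSpace S`. -/
theorem restrictTo_mem_realSpace {c : Fam} (hsupp : ∀ k ∉ S, c k = 0)
    (hct : ∀ k : Fin 3 → ℤ, ∑ j : Fin 3, ((k j : ℤ) : ℂ) * c k j = 0) (hcI : IsClassI c)
    (hcJ : Torus.IsConjSymm c) : restrictTo S c ∈ AbcClassI.realSpace S := by
  refine ⟨?_, ?_, ?_⟩ <;> rw [extend_restrictTo c hsupp]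
  exacts [hct, hcI, hcJ]

/-- **Real completeness on one orbit**: a transversal, class-I, conjugate-symmetric family supported
in an orbit is the REAL combination of the basis families with coefficients the real inner products. -/
theorem expand_real (O : Orbit) {c : Fam} (hsupp : ∀ k ∉ O.1, c k = 0)
    (hct : ∀ k : Fin 3 → ℤ, ∑ j : Fin 3, ((k j : ℤ) : ℂ) * c k j = 0) (hcI : IsClassI c)
    (hcJ : Torus.IsConjSymm c) :
    c = ∑ a : Fin (AbcClassI.odim O), ((inner ℝ (AbcClassI.orbitBasis O a)
      (⟨restrictTo O.1 c, restrictTo_mem_realSpace hsupp hct hcI hcJ⟩ : AbcClassI.realSpace O.1) : ℝ) : ℂ) •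
        AbcClassI.bfam ⟨O, a⟩ := by
  set u : realSpace O.1 := ⟨restrictTo O.1 c, restrictTo_mem_realSpace hsupp hct hcI hcJ⟩ with hu
  have h : ∑ a : Fin (odim O), (inner ℝ (orbitBasis O a) u : ℝ) • orbitBasis O a = u := by
    have := (orbitBasis O).sum_repr u
    simpa only [OrthonormalBasis.repr_apply_apply] using this
  have h1 : ((∑ a : Fin (odim O), (inner ℝ (orbitBasis O a) u : ℝ) • orbitBasis O a : realSpace O.1) :
      EuclideanSpace ℂ (↥O.1 × Fin 3)) = restrictTo O.1 c := by
    rw [h]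
  rw [Submodule.coe_sum] at h1
  simp only [Submodule.coe_smul, real_smul_eq] at h1
  have h2 := congrArg (extend O.1) h1
  rw [extend_restrictTo c hsupp, extend_sum] at h2
  rw [← h2]
  refine Finset.sum_congr rfl fun a _ => ?_
  rw [extend_smul, bfam_eq]

/-- **Coefficients of an expansion are the pairings with the basis families** (orthonormality). -/
theorem coeff_eq_sum_inner (O : Orbit) {c : Fam} {z : Fin (AbcClassI.odim O) → ℂ}
    (h : c = ∑ a : Fin (AbcClassI.odim O), z a • AbcClassI.bfam ⟨O, a⟩) (a : Fin (AbcClassI.odim O)) :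
    z a = ∑ k ∈ O.1, (inner ℂ (AbcClassI.bfam ⟨O, a⟩ k) (c k) : ℂ) := by
  rw [h]
  simp only [Finset.sum_apply, inner_sum, Pi.smul_apply, inner_smul_right]
  rw [Finset.sum_comm]
  simp_rw [← Finset.mul_sum]
  have horth : ∀ a' : Fin (odim O), ∑ k ∈ O.1, (inner ℂ (bfam ⟨O, a⟩ k) (bfam ⟨O, a'⟩ k) : ℂ) =
      if (⟨O, a⟩ : Idx) = ⟨O, a'⟩ then 1 else 0 := fun a' => sum_inner_bfam (i := ⟨O, a⟩) le_rfl ⟨O, a'⟩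
  simp_rw [horth]
  have hite : ∀ a' : Fin (odim O), (if (⟨O, a⟩ : Idx) = ⟨O, a'⟩ then (1 : ℂ) else 0) = if a = a' then 1 else 0 := by
    intro a'
    by_cases ha : a = a'
    · subst ha; simp
    · rw [if_neg ha, if_neg]
      intro he; exact ha (eq_of_heq (Sigma.mk.inj_iff.mp he).2)
  simp_rw [hite, mul_ite, mul_one, mul_zero]
  rw [Finset.sum_ite_eq Finset.univ a]
  simp

/-- **Complex completeness on one orbit (existence)**: a transversal class-I family supported in an
orbit is a COMPLEX combination of the basis families (`c = ½((c + Jc) − i·i(c − Jc))`, both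
`c + Jc` and `i(c − Jc)` being conjugate-symmetric, transversal and class I). -/
theorem exists_expand_complex (O : Orbit) {c : Fam} (hsupp : ∀ k ∉ O.1, c k = 0)
    (hct : ∀ k : Fin 3 → ℤ, ∑ j : Fin 3, ((k j : ℤ) : ℂ) * c k j = 0) (hcI : IsClassI c) :
    ∃ z : Fin (AbcClassI.odim O) → ℂ, c = ∑ a : Fin (AbcClassI.odim O), z a • AbcClassI.bfam ⟨O, a⟩ := by
  set J : Fam := fun k => conjVec (c (-k)) with hJ
  have hS := neg_mem_of_orbitClosed O.orbitClosed
  have hJsupp : ∀ k ∉ O.1, J k = 0 := fun k hk => conj_eq_zero_of_not_mem hS hsupp k hk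
  have hJt : ∀ k : Fin 3 → ℤ, ∑ j : Fin 3, ((k j : ℤ) : ℂ) * J k j = 0 := kdot_conj hct
  have hJI : IsClassI J := hcI.conj
  -- g = c + Jc, h = i (c − Jc): conjugate-symmetric, transversal, class I, supported in O
  have hg := expand_real O (c := c + J) (fun k hk => by simp [hsupp k hk, hJsupp k hk])
    (fun k => by rw [Pi.add_apply, kdot_add, hct k, hJt k, add_zero]) (hcI.add hJI)
    (AbcLatticeReality.isConjSymm_add_conj c)
  have hh := expand_real O (c := Complex.I • (c - J)) (fun k hk => by simp [hsupp k hk, hJsupp k hk])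
    (fun k => by rw [Pi.smul_apply, kdot_smul, Pi.sub_apply, kdot_sub', hct k, hJt k, sub_zero, mul_zero])
    ((hcI.sub hJI).smul Complex.I) (AbcLatticeReality.isConjSymm_I_smul_sub_conj c)
  -- abbreviate the real coefficient vectors
  obtain ⟨r, hg⟩ : ∃ r : Fin (odim O) → ℂ, c + J = ∑ a : Fin (odim O), r a • bfam ⟨O, a⟩ := ⟨_, hg⟩
  obtain ⟨s, hh⟩ : ∃ s : Fin (odim O) → ℂ, Complex.I • (c - J) = ∑ a : Fin (odim O), s a • bfam ⟨O, a⟩ :=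
    ⟨_, hh⟩
  refine ⟨fun a => (1 / 2 : ℂ) * (r a - Complex.I * s a), ?_⟩
  have key : c = (1 / 2 : ℂ) • ((c + J) - Complex.I • (Complex.I • (c - J))) := by
    funext k; ext p
    simp only [Pi.smul_apply, Pi.add_apply, Pi.sub_apply, PiLp.smul_apply, PiLp.add_apply,
      PiLp.sub_apply, smul_eq_mul]
    ring_nf
    rw [Complex.I_sq]
    ring
  calc c = (1 / 2 : ℂ) • ((c + J) - Complex.I • (Complex.I • (c - J))) := key
    _ = (1 / 2 : ℂ) • ((∑ a : Fin (odim O), r a • bfam ⟨O, a⟩) -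
          Complex.I • ∑ a : Fin (odim O), s a • bfam ⟨O, a⟩) := by
        rw [← hh, ← hg]
    _ = ∑ a : Fin (odim O), ((1 / 2 : ℂ) * (r a - Complex.I * s a)) • bfam ⟨O, a⟩ := by
        rw [Finset.smul_sum, ← Finset.sum_sub_distrib, Finset.smul_sum]
        refine Finset.sum_congr rfl fun a _ => ?_
        rw [smul_smul, ← sub_smul, smul_smul]

/-- **Complex completeness on one orbit**: a transversal class-I family supported in the orbit `O`
equals `Σ_a (Σ_{k∈O} ⟪bfam ⟨O,a⟩ k, c k⟫) • bfam ⟨O,a⟩`. In particular such a family orthogonal to all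
`bfam ⟨O, a⟩` vanishes. -/
theorem expand_complex (O : Orbit) {c : Fam} (hsupp : ∀ k ∉ O.1, c k = 0)
    (hct : ∀ k : Fin 3 → ℤ, ∑ j : Fin 3, ((k j : ℤ) : ℂ) * c k j = 0) (hcI : IsClassI c) :
    c = ∑ a : Fin (AbcClassI.odim O), (∑ k ∈ O.1, (inner ℂ (AbcClassI.bfam ⟨O, a⟩ k) (c k) : ℂ)) • AbcClassI.bfam ⟨O, a⟩ := by
  obtain ⟨z, hz⟩ := exists_expand_complex O hsupp hct hcI
  have hz' : ∀ a, z a = ∑ k ∈ O.1, (inner ℂ (bfam ⟨O, a⟩ k) (c k) : ℂ) := coeff_eq_sum_inner O hz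
  conv_lhs => rw [hz]
  exact Finset.sum_congr rfl fun a _ => by rw [hz' a]

/-- **A transversal class-I family supported in an orbit and orthogonal to its basis families is zero.** -/
theorem eq_zero_of_orthogonal (O : Orbit) {c : Fam} (hsupp : ∀ k ∉ O.1, c k = 0)
    (hct : ∀ k : Fin 3 → ℤ, ∑ j : Fin 3, ((k j : ℤ) : ℂ) * c k j = 0) (hcI : IsClassI c)
    (horth : ∀ a : Fin (AbcClassI.odim O), ∑ k ∈ O.1, (inner ℂ (AbcClassI.bfam ⟨O, a⟩ k) (c k) : ℂ) = 0) : c = 0 := by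
  rw [expand_complex O hsupp hct hcI]
  exact Finset.sum_eq_zero fun a _ => by rw [horth a, zero_smul]

/-- **The orbit dimension is uniformly bounded**: `odim O ≤ 288 = 2·3·48`. -/
theorem odim_le (O : Orbit) : AbcClassI.odim O ≤ 288 := by
  have h1 : Module.finrank ℝ (realSpace O.1) ≤ Module.finrank ℝ (EuclideanSpace ℂ (↥O.1 × Fin 3)) :=
    Submodule.finrank_le _
  have h2 : Module.finrank ℝ (EuclideanSpace ℂ (↥O.1 × Fin 3)) =
      2 * Module.finrank ℂ (EuclideanSpace ℂ (↥O.1 × Fin 3)) := finrank_real_of_complex _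
  rw [finrank_euclideanSpace, Fintype.card_prod, Fintype.card_coe, Fintype.card_fin] at h2
  have h3 := O.card_le
  show Module.finrank ℝ (realSpace O.1) ≤ 288
  omega

end Basis

end Summit.NavierStokesRegularity.FluidComputer.AbcClassI

end
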